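import Summits.QuantumAdvantage.QuantumAdvantage.Theorems.CubicForrelationNearExactIsExactCubicForm
import Summits.QuantumAdvantage.QuantumAdvantage.Theorems.CubicForrelationSignedCubicForrelationNotPrBPPStubKernelNormalFormDegree
import Mathlib.Logic.Equiv.Fin.Basic

/-!
# Crux `CubicForrelation.NearExactIsExact` (stmt-QuantumAdvantage-14043) — restricting a Boolean function to the coordinate hyperplanes `{y₀ = b}`

Certificate seat `b2b-cforr-cert` (gen 40).  HONEST FRAMING: kernel-checked bookkeeping (standard axioms), the one-coordinate analogue of
…CubicFormCells, to be used after …CubicFormFrameOne (`tcr1_adapted_frame` turns the Kasami–Tokura hyperplane of a light cell into `{y₀ = b}`)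
in the light-cell analysis of `E1280-even` (HOME/b2b-cforr-cert-g40/LEAN-PLAN-E1280-EVEN.md §4–5).  Nothing about `θ₁₂`; NOT summit progress.

For `κ : 𝔽₂^{1+m} → 𝔽₂` and `b ∈ 𝔽₂` put `ρ_b(s) = κ(b, s)` (`Fin.append ![b] s`).
* `tco_card_halves`: `#κ = #ρ₀ + #ρ₁`;  `tco_card_of_support`: if `supp κ ⊆ {y₀ = b}` then `#κ = #ρ_b`.
* `tco_rho_isDegLeFun`: `ρ_b` has degree `≤ d` if `κ` has.
* `tco_second_rho`: the second differences of `ρ_b` are those of `κ` on the embedded vectors (so the alternating form of `ρ_b` is the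
  restriction of that of `κ` to the hyperplane directions).

References: folklore.  Axioms: the standard three.
-/

set_option linter.dupNamespace false -- D-0017: single-problem summit ⇒ `QuantumAdvantage.QuantumAdvantage` by design

namespace Summit.QuantumAdvantage.QuantumAdvantage.Theorems.CubicForrelation.NearExactIsExact

open Finset
open Literature.Computability.QuantumComplexity
open Literature.Computability.QuantumComplexity.BuzetChailloux (bxor zeroVec bxor_zeroVec zeroVec_bxor)
open Summit.QuantumAdvantage.QuantumAdvantage.Theorems.SignedCubicForrelationNotPrBPP (knf_isDegLeFun_comp)

variable {m : ℕ}

/-- Xor of appended vectors (one leading coordinate). [folklore] -/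
theorem tco_append_bxor (v v' : Fin 1 → Bool) (s s' : Fin m → Bool) :
    bxor (Fin.append v s) (Fin.append v' s') = Fin.append (bxor v v') (bxor s s') := by
  funext l
  refine Fin.addCases (fun i => ?_) (fun σ => ?_) l
  · simp only [bxor, Fin.append_left]
  · simp only [bxor, Fin.append_right]

/-- **Counting by the leading coordinate**: `#κ = #ρ₀ + #ρ₁`. [folklore] -/
theorem tco_card_halves (κ : (Fin (1 + m) → Bool) → Bool) :
    #(univ.filter fun y : Fin (1 + m) → Bool => κ y = true) =
      #(univ.filter fun s : Fin m → Bool => κ (Fin.append ![false] s) = true) +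
        #(univ.filter fun s : Fin m → Bool => κ (Fin.append ![true] s) = true) := by
  classical
  rw [card_filter, ← Fintype.sum_equiv (Fin.appendEquiv 1 m) (fun vs => if κ (Fin.append vs.1 vs.2) = true then 1 else 0)
    (fun y => if κ y = true then 1 else 0) (fun vs => rfl), Fintype.sum_prod_type]
  have hsum : ∀ F : (Fin 1 → Bool) → ℕ, ∑ v : Fin 1 → Bool, F v = F ![false] + F ![true] := by
    intro F
    let e : (Fin 1 → Bool) ≃ Bool := ⟨fun c => c 0, fun t => ![t], fun c => by funext i; fin_cases i; rfl, fun t => rfl⟩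
    rw [Fintype.sum_equiv e F (fun t => F ![t]) (fun c => by show F c = F ![c 0]; congr 1; funext i; fin_cases i; rfl), Fintype.sum_bool]
    ring
  rw [hsum, card_filter, card_filter]

/-- If `supp κ ⊆ {y₀ = b}` then `#κ = #ρ_b`. [folklore] -/
theorem tco_card_of_support (κ : (Fin (1 + m) → Bool) → Bool) (b : Bool)
    (hsupp : ∀ y, κ y = true → y (Fin.castAdd m (0 : Fin 1)) = b) :
    #(univ.filter fun y : Fin (1 + m) → Bool => κ y = true) = #(univ.filter fun s : Fin m → Bool => κ (Fin.append ![b] s) = true) := by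
  rw [tco_card_halves]
  have hzero : ∀ b', b' ≠ b → #(univ.filter fun s : Fin m → Bool => κ (Fin.append ![b'] s) = true) = 0 := by
    intro b' hb'
    rw [card_eq_zero, filter_eq_empty_iff]
    intro s _ hs
    have := hsupp _ hs
    rw [Fin.append_left] at this
    exact hb' this
  cases b
  · rw [hzero true (by decide), add_zero]
  · rw [hzero false (by decide), zero_add]

/-- The coordinates of `s ↦ (v, s)` are affine. [folklore] -/
theorem tco_append_coord_deg (v : Fin 1 → Bool) (l : Fin (1 + m)) : IsDegLeFun 1 (fun s : Fin m → Bool => Fin.append v s l) := by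
  refine Fin.addCases (fun i => ?_) (fun σ => ?_) l
  · have : (fun s : Fin m → Bool => Fin.append v s (Fin.castAdd m i)) = fun _ => v i := by
      funext s; exact Fin.append_left v s i
    rw [this]; exact isDegLeFun_const 1 (v i)
  · have : (fun s : Fin m → Bool => Fin.append v s (Fin.natAdd 1 σ)) = fun s => s σ := by
      funext s; exact Fin.append_right v s σ
    rw [this]; exact isDegLeFun_apply σ le_rfl

/-- **The restrictions keep the degree.** [folklore] -/
theorem tco_rho_isDegLeFun {d : ℕ} (κ : (Fin (1 + m) → Bool) → Bool) (hκ : IsDegLeFun d κ) (v : Fin 1 → Bool) :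
    IsDegLeFun d (fun s : Fin m → Bool => κ (Fin.append v s)) :=
  knf_isDegLeFun_comp hκ _ fun l => tco_append_coord_deg v l

/-- **Second differences of a restriction** are those of `κ` on the embedded vectors. [folklore] -/
theorem tco_second_rho (κ : (Fin (1 + m) → Bool) → Bool) (v : Fin 1 → Bool) (s t x : Fin m → Bool) :
    let ρ : (Fin m → Bool) → Bool := fun s => κ (Fin.append v s)
    let ι : (Fin m → Bool) → (Fin (1 + m) → Bool) := fun u => Fin.append (zeroVec : Fin 1 → Bool) u
    ((ρ x ^^ ρ (bxor x t)) ^^ (ρ (bxor x s) ^^ ρ (bxor (bxor x s) t))) =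
      ((κ (Fin.append v x) ^^ κ (bxor (Fin.append v x) (ι t))) ^^
        (κ (bxor (Fin.append v x) (ι s)) ^^ κ (bxor (bxor (Fin.append v x) (ι s)) (ι t)))) := by
  intro ρ ι
  simp only [ρ, ι, tco_append_bxor, bxor_zeroVec]

/-- The embedded unit vectors: `ι e_σ = e_{1+σ}`. [folklore] -/
theorem tco_unit_right (σ : Fin m) :
    (fun l : Fin (1 + m) => decide (l = Fin.natAdd 1 σ)) = Fin.append (zeroVec : Fin 1 → Bool) (fun l : Fin m => decide (l = σ)) := by
  funext l
  refine Fin.addCases (fun i => ?_) (fun τ => ?_) l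
  · simp only [Fin.append_left, zeroVec]
    have : Fin.castAdd m i ≠ Fin.natAdd 1 σ := by
      intro e
      have := congrArg Fin.val e
      simp only [Fin.val_natAdd, Fin.val_castAdd] at this
      omega
    simp [this]
  · simp only [Fin.append_right]
    by_cases h : τ = σ
    · subst h; simp
    · have : Fin.natAdd 1 τ ≠ Fin.natAdd 1 σ := fun e => h (Fin.natAdd_inj 1 |>.mp e)
      simp [h, this]

end Summit.QuantumAdvantage.QuantumAdvantage.Theorems.CubicForrelation.NearExactIsExact
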